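import Literature.AnabelianGeometry.EtaleTheta.Discharge.Sec3Cor38iiiOfIsFrobenioidWeak
import Literature.AnabelianGeometry.EtaleTheta.Discharge.Sec3RealifiedCuspidalWeak
import Literature.AnabelianGeometry.EtaleTheta.Discharge.Sec3RealifiedCuspidalDisjointWeak
import Literature.AnabelianGeometry.EtaleTheta.NoPhantomSupport
import Literature.AnabelianGeometry.EtaleTheta.Discharge.Sec3BsFldNcspWeak
import Literature.AnabelianGeometry.EtaleTheta.DivisorMonoidsConstants34
import HarnessLib

/-!
# [EtTh] Cor. 3.8 (iii), pre-steps, for tempered Frobenioids over THE realified divisor monoids of the WEAK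
# vocabulary (`ofRlfZWeak`): the Def. 3.1 / 3.6 (iii) data axioms DISCHARGED and the corollary ASSEMBLED

Mochizuki, *The étale theta function …*, Publ. RIMS **45** (2009), Def. 3.1 (i) p.70, Def. 3.6 (iii) p.77,
Cor. 3.8 (iii) pp.80–82 [cite: MochizukiEtTh2009, Cor 3.8 p.81].

WEAK-VOCABULARY TWIN of `Discharge/Sec3Cor38iiiOfRlf.lean` (abc-iut-L2-d2 gen 2, p416187), piece (H) of
the abc-iut cell's F-L2d2-1 / F-L2d2-2 repair chain: the realified base data are abc-iut-L6-t12's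
`RealifiedDivisorMonoids.ofRlfZWeak dm hpf` over abc-iut-L2-t3's `treeMonoidVocabWeak` with
`hpf : ∀ Y, IsPerfFactorialCof (Φ₀ Y)` — the repaired reading of [EtTh] Prop. 3.4 (i) that holds at tempered
coverings with infinitely many special-fibre components (`Ÿ`, `Z_∞`), where the printed hypothesis of
`ofRlfZ` is unsatisfiable.
* over `C : TemperedFrobenioid (ofRlfZWeak dm hpf) D VD` (text drafted by abc-iut-L6-t12, 04:37Z, filed
  here with credit): (`hDa`) `eq_one_of_isNonCuspidal_of_isCuspidal_weak` (from L6-t12's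
  `ofRlfZWeak_disjoint_toRSuppOf`, `Sec3RealifiedCuspidalDisjointWeak.lean`), (`hDn`/`hDc`, ⇒)
  `isNonCuspidal_of_precsim_weak` / `isCuspidal_of_precsim_weak` (L6-t12's (R1)/(R2),
  `Sec3RealifiedCuspidalWeak.lean`), (⇐) from (R3) "no phantom support" by name:
  `isNonCuspidal_iff_primaries_of_noPhantom_weak` / `isCuspidal_iff_primaries_of_noPhantom_weak`;
* the ASSEMBLY **`cor38_iii_ofRlfZWeak`** — the strong file's assembly verbatim over this seat's (K) twin
  `cor38_iii_of_weak` (`Sec3CuspidalPreStepsWeak`, `Sec3Cor38iiiWeak`): [EtTh] Cor. 3.8 (iii), first clause, PROVED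
  at the weak realified data modulo the named inputs of the strong file ([FrdI] Thm. 3.4 (ii)/(iii), Thm. 4.2 (i)
  `hprim`/`hprim'`, the datum "base-field-theoretic ⇒ non-cuspidal" `hD1`, and (R3) `hR3`);
* **the [FrdI] rows DISCHARGED**: `cor38_iii_ofRlfZWeak_of_isFrobenioid` — Thm. 3.4 (ii) (C38-L02a, the tree's
  PROVED `FrdI.thm34ii_ofFunctor` over print's FSMFF bases `h.fsmff`), Thm. 3.7 (i)(ii) (C38-L01, no residual over
  the weak vocabulary) and Thm. 4.2 (i) for WEAKLY perf-factorial `Φ_i` (abc-iut-L1-t12's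
  `FrdI.T42.isPrimaryPreStep_map_of_preservesPreSteps_weak`) all by name through this seat's
  `Cor38Hyp.cor38_iii_of_isFrobenioid_weak` (`Sec3Cor38iiiOfIsFrobenioidWeak.lean`) — remaining inputs
  `IsFrobenioid` ([FrdI] Thm. 5.2 (ii)), `hD1`, `hR3`;
* **(R3) discharged for countably many primes**: `noPhantom_of_countable_weak` (from this seat's
  `NoPhantomSupport.lean` — cofinality + countability kill phantom functionals), whence
  `cor38_iii_ofRlfZWeak_of_isFrobenioid_of_countable` with NO (R3) hypothesis; and with `hD1` reduced to the
  `Φ₀`-datum "divisors of constants are quotients of non-cuspidal log-divisors" (`Sec3BsFldNcspWeak.lean`):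
  **`cor38_iii_ofRlfZWeak_of_isFrobenioid_of_countable_of_cnst` — [EtTh] Cor. 3.8 (iii), first clause, at the
  weak realified data `ofRlfZWeak` modulo ONLY `IsFrobenioid`, countability of the primes of the `Φ_i(A)`
  (GAP-LEDGER G-L2d2-4) and the `Φ₀`-datum `hcn` (G-L2d2-3)** — no [FrdI] Thm. 3.4 / 4.2 binder, no FSM-type
  hypothesis, no row of the printed proof left as an input.
* (v2, append-only) **`cor38_iii_ofRlfZWeak_of_isFrobenioid_of_countable_of_prop34Const`** — the `Φ₀`-datum `hcn`
  (GAP-LEDGER G-L2d2-3) supplied BY NAME from abc-iut-L2-t3's Prop. 3.4 (ii) predicate bundle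
  `DivisorMonoids.Prop34Const` (`DivisorMonoidsConstants34.lean`, `Prop34Const.hcn`; disposition D-G-L2d2-3):
  remaining inputs `IsFrobenioid`, `hcnt` (G-L2d2-4), `(hC_i : dm_i.Prop34Const)`.
Theorems only.  Seat abc-iut-L2-d2 (gens 3–4; the data lemmas of §1 were drafted by abc-iut-L6-t12, 04:37Z).  HONEST FRAMING: classical theory of tempered Frobenioids;
nothing here bears on [IUTchIII] Cor. 3.12.
-/

namespace Literature.AnabelianGeometry.EtaleTheta

open CategoryTheory Opposite Literature.AlgebraicGeometry.Frobenioids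

universe u₀ v₀ u v w

/-! ### Tempered Frobenioids over `ofRlfZWeak`: the data axioms of `cor38_iii_of` -/

namespace TemperedFrobenioid

variable {D₀ : Type u₀} [Category.{v₀} D₀] {dm : DivisorMonoids.{u₀, v₀, w} D₀}
  {hpf : ∀ Y : D₀ᵒᵖ, IsPerfFactorialCof (dm.Φ₀.obj Y)}
  {D : Type u} [Category.{v} D] {VD : FrdICatStub.{u, v, w} D}

/-- Unfolding: over `ofRlfZWeak`, `x ∈ Φ(A)` is non-cuspidal iff its support (in `Φ₀(Y_A)^rlf_factor`)
consists of non-cuspidal primes. [cite: MochizukiEtTh2009, Def 3.6 p.77] -/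
theorem isNonCuspidal_iff_supp_weak
    (C : TemperedFrobenioid (RealifiedDivisorMonoids.ofRlfZWeak dm hpf) D VD) {A : Dᵒᵖ} (x : C.Φ.carrier A) :
    C.IsNonCuspidal x ↔
      supp ((hpf (C.baseOp A)).weak.realification.subtype (x : C.ΦRlog.obj A)) ⊆
        RealifiedDivisorMonoids.toRSuppOfWeak dm hpf (C.baseOp A) (dm.ncsp₀ (C.baseOp A)) :=
  Iff.rfl

/-- Unfolding: over `ofRlfZWeak`, `x ∈ Φ(A)` is cuspidal iff its support consists of cuspidal primes.
[cite: MochizukiEtTh2009, Def 3.6 p.77] -/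
theorem isCuspidal_iff_supp_weak
    (C : TemperedFrobenioid (RealifiedDivisorMonoids.ofRlfZWeak dm hpf) D VD) {A : Dᵒᵖ} (x : C.Φ.carrier A) :
    C.IsCuspidal x ↔
      supp ((hpf (C.baseOp A)).weak.realification.subtype (x : C.ΦRlog.obj A)) ⊆
        RealifiedDivisorMonoids.toRSuppOfWeak dm hpf (C.baseOp A) (dm.csp₀ (C.baseOp A)) :=
  Iff.rfl

/-- **(`hDa`) An element of `Φ(A)` that is both non-cuspidal and cuspidal is trivial** — DISCHARGED over
`ofRlfZWeak`. [cite: MochizukiEtTh2009, Def 3.6 p.77] -/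
theorem eq_one_of_isNonCuspidal_of_isCuspidal_weak
    (C : TemperedFrobenioid (RealifiedDivisorMonoids.ofRlfZWeak dm hpf) D VD) {A : Dᵒᵖ} (x : C.Φ.carrier A)
    (hn : C.IsNonCuspidal x) (hc : C.IsCuspidal x) : x = 1 := by
  have h1 : ((x : C.ΦRlog.obj A) : (hpf (C.baseOp A)).weak.Rlf) = 1 :=
    RealifiedDivisorMonoids.ofRlfZWeak_eq_one_of_mem_ncspR_of_mem_cspR dm hpf (C.baseOp A)
      (RealifiedDivisorMonoids.ofRlfZWeak_disjoint_toRSuppOf dm hpf _) hn hc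
  exact Subtype.ext h1

/-- `y ≼ x` in `Φ(A)` gives `y ∣ x^n` in `Φ^{ℝ-log}(A)` for some `n ≥ 1` (weak data).
[cite: MochizukiEtTh2009, Def 3.6 p.77] -/
theorem exists_dvd_pow_of_precsim_weak
    (C : TemperedFrobenioid (RealifiedDivisorMonoids.ofRlfZWeak dm hpf) D VD) {A : Dᵒᵖ} {x y : C.Φ.carrier A} (h : Precsim y x) :
    ∃ n : ℕ, n ≠ 0 ∧ ((C.Φ.carrier A).subtype y : (hpf (C.baseOp A)).weak.Rlf) ∣
      ((C.Φ.carrier A).subtype x : (hpf (C.baseOp A)).weak.Rlf) ^ n := by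
  obtain ⟨n, hn, hyx⟩ := h
  refine ⟨n, hn.ne', ?_⟩
  rw [← map_pow]
  exact map_dvd _ hyx

/-- **(`hDn`, ⇒) Non-cuspidality descends along `≼`** over `ofRlfZWeak` (down- and root-closedness of
`Φ₀^ℝ(Y)^ncsp`). [cite: MochizukiEtTh2009, Def 3.6 p.77] -/
theorem isNonCuspidal_of_precsim_weak
    (C : TemperedFrobenioid (RealifiedDivisorMonoids.ofRlfZWeak dm hpf) D VD) {A : Dᵒᵖ} {x y : C.Φ.carrier A} (hyx : Precsim y x)
    (hx : C.IsNonCuspidal x) : C.IsNonCuspidal y := by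
  obtain ⟨n, hn, hdvd⟩ := C.exists_dvd_pow_of_precsim_weak hyx
  exact RealifiedDivisorMonoids.ofRlfZWeak_ncspR_of_dvd dm hpf _ hdvd
    ((RealifiedDivisorMonoids.ofRlfZWeak_pow_mem_ncspR_iff dm hpf _ _ hn).2 hx)

/-- **(`hDc`, ⇒) Cuspidality descends along `≼`** over `ofRlfZWeak`. [cite: MochizukiEtTh2009, Def 3.6 p.77] -/
theorem isCuspidal_of_precsim_weak
    (C : TemperedFrobenioid (RealifiedDivisorMonoids.ofRlfZWeak dm hpf) D VD) {A : Dᵒᵖ} {x y : C.Φ.carrier A} (hyx : Precsim y x)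
    (hx : C.IsCuspidal x) : C.IsCuspidal y := by
  obtain ⟨n, hn, hdvd⟩ := C.exists_dvd_pow_of_precsim_weak hyx
  exact RealifiedDivisorMonoids.ofRlfZWeak_cspR_of_dvd dm hpf _ hdvd
    ((RealifiedDivisorMonoids.ofRlfZWeak_pow_mem_cspR_iff dm hpf _ _ hn).2 hx)

/-- **(`hDn`) "`x` is non-cuspidal iff every primary `y ≼ x` of `Φ(A)` is"** — over `ofRlfZWeak`, from
the hypothesis (R3) "no phantom support": every prime in the support of `x` lies in the support of some
primary `y ≼ x` of `Φ(A)`. [cite: MochizukiEtTh2009, Def 3.6 p.77] -/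
theorem isNonCuspidal_iff_primaries_of_noPhantom_weak
    (C : TemperedFrobenioid (RealifiedDivisorMonoids.ofRlfZWeak dm hpf) D VD) {A : Dᵒᵖ}
    (hR3 : ∀ (x : C.Φ.carrier A) (𝔮 : Primes (Perfection (dm.Φ₀.obj (C.baseOp A)))),
      𝔮 ∈ supp ((hpf (C.baseOp A)).weak.realification.subtype (x : C.ΦRlog.obj A)) →
        ∃ y : C.Φ.carrier A, IsPrimary y ∧ Precsim y x ∧
          𝔮 ∈ supp ((hpf (C.baseOp A)).weak.realification.subtype (y : C.ΦRlog.obj A)))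
    (x : C.Φ.carrier A) :
    C.IsNonCuspidal x ↔ ∀ y : C.Φ.carrier A, IsPrimary y → Precsim y x → C.IsNonCuspidal y := by
  refine ⟨fun hx y _ hyx => C.isNonCuspidal_of_precsim_weak hyx hx, fun h => ?_⟩
  rw [isNonCuspidal_iff_supp_weak]
  intro 𝔮 h𝔮
  obtain ⟨y, hy, hyx, hy𝔮⟩ := hR3 x 𝔮 h𝔮
  exact (C.isNonCuspidal_iff_supp_weak y).1 (h y hy hyx) hy𝔮

/-- **(`hDc`) "`x` is cuspidal iff every primary `y ≼ x` of `Φ(A)` is"** — over `ofRlfZWeak`, from (R3).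
[cite: MochizukiEtTh2009, Def 3.6 p.77] -/
theorem isCuspidal_iff_primaries_of_noPhantom_weak
    (C : TemperedFrobenioid (RealifiedDivisorMonoids.ofRlfZWeak dm hpf) D VD) {A : Dᵒᵖ}
    (hR3 : ∀ (x : C.Φ.carrier A) (𝔮 : Primes (Perfection (dm.Φ₀.obj (C.baseOp A)))),
      𝔮 ∈ supp ((hpf (C.baseOp A)).weak.realification.subtype (x : C.ΦRlog.obj A)) →
        ∃ y : C.Φ.carrier A, IsPrimary y ∧ Precsim y x ∧
          𝔮 ∈ supp ((hpf (C.baseOp A)).weak.realification.subtype (y : C.ΦRlog.obj A)))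
    (x : C.Φ.carrier A) :
    C.IsCuspidal x ↔ ∀ y : C.Φ.carrier A, IsPrimary y → Precsim y x → C.IsCuspidal y := by
  refine ⟨fun hx y _ hyx => C.isCuspidal_of_precsim_weak hyx hx, fun h => ?_⟩
  rw [isCuspidal_iff_supp_weak]
  intro 𝔮 h𝔮
  obtain ⟨y, hy, hyx, hy𝔮⟩ := hR3 x 𝔮 h𝔮
  exact (C.isCuspidal_iff_supp_weak y).1 (h y hy hyx) hy𝔮

/-- **(R3) "no phantom support" DISCHARGED over `ofRlfZWeak` when `Φ(A)` has countably many primes** (the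
geometric case: special-fibre components indexed by `ℤ`, finitely many cusps): every prime of `Φ₀(Y_A)^pf`
in the support of `x ∈ Φ(A)` lies in the support of some primary `y ≼ x` of `Φ(A)` — this seat's
`IsPerfFactorialWeak.exists_isPrimary_precsim_mem_supp` (cofinality of `Φ(A)^pf` in `Φ(A)^rlf` is part of
`IsPerfFactorialCof`, Def. 3.6 (ii) over the weak vocabulary). [cite: MochizukiEtTh2009, Cor 3.8 p.82] -/
theorem noPhantom_of_countable_weak
    (C : TemperedFrobenioid (RealifiedDivisorMonoids.ofRlfZWeak dm hpf) D VD) (A : Dᵒᵖ)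
    (hcnt : Countable (Primes (Perfection ↥(C.Φ.carrier A)))) (x : C.Φ.carrier A)
    (𝔮 : Primes (Perfection (dm.Φ₀.obj (C.baseOp A))))
    (h𝔮 : 𝔮 ∈ supp ((hpf (C.baseOp A)).weak.realification.subtype (x : C.ΦRlog.obj A))) :
    ∃ y : C.Φ.carrier A, IsPrimary y ∧ Precsim y x ∧
      𝔮 ∈ supp ((hpf (C.baseOp A)).weak.realification.subtype (y : C.ΦRlog.obj A)) :=
  (C.isPerfFactorial A).elim fun hw hcof =>
    @IsPerfFactorialWeak.exists_isPrimary_precsim_mem_supp _ _ (hpf (C.baseOp A)).weak (C.Φ.carrier A) hw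
      hcof hcnt x 𝔮 h𝔮

end TemperedFrobenioid

/-! ### Cor. 3.8 (iii) (pre-steps) for tempered Frobenioids over `ofRlfZWeak` data -/

section Cor38Weak

variable {D₀ : Type u₀} [Category.{v₀} D₀] {dm : DivisorMonoids.{u₀, v₀, w} D₀}
  {hpf : ∀ Y : D₀ᵒᵖ, IsPerfFactorialCof (dm.Φ₀.obj Y)}
  {D : Type u} [Category.{v} D] {VD : FrdICatStub.{u, v, w} D}
  {D₀' : Type u₀} [Category.{v₀} D₀'] {dm' : DivisorMonoids.{u₀, v₀, w} D₀'}
  {hpf' : ∀ Y : D₀'ᵒᵖ, IsPerfFactorialCof (dm'.Φ₀.obj Y)}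
  {D' : Type u} [Category.{v} D'] {VD' : FrdICatStub.{u, v, w} D'}
  {C₁ : TemperedFrobenioid (RealifiedDivisorMonoids.ofRlfZWeak dm hpf) D VD}
  {C₂ : TemperedFrobenioid (RealifiedDivisorMonoids.ofRlfZWeak dm' hpf') D' VD'} (h : Cor38Hyp C₁ C₂)

open TemperedFrobenioid

/-- **Cor. 3.8 (iii), pre-step clause, for tempered Frobenioids over the realified data `ofRlfZWeak`**: the
data axioms `hDa`, `hDn`, `hDc` of `cor38_iii_of` are discharged (the last two from (R3)); remaining named
inputs: [FrdI] Thm. 3.4 (ii)/(iii) and Thm. 4.2 (i) for `Ψ^{±1}` (`hpre`…`hfrob'`), abc-iut-L2-t3's datum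
"base-field-theoretic ⇒ non-cuspidal" (`hD1`) and (R3) (`hR3`). [cite: MochizukiEtTh2009, Cor 3.8 p.81] -/
theorem cor38_iii_ofRlfZWeak
    (hpre : ∀ ⦃X Y : C₁.category⦄ (φ : X ⟶ Y),
      PreFrobenioid.IsPreStep C₁.toElem φ → PreFrobenioid.IsPreStep C₂.toElem (h.Ψ.functor.map φ))
    (hpre' : ∀ ⦃X Y : C₂.category⦄ (φ : X ⟶ Y),
      PreFrobenioid.IsPreStep C₂.toElem φ → PreFrobenioid.IsPreStep C₁.toElem (h.Ψ.inverse.map φ))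
    (hprim : ∀ ⦃X Y : C₁.category⦄ (φ : X ⟶ Y), PreFrobenioid.IsPrimaryPreStep C₁.toElem φ →
      PreFrobenioid.IsPrimaryPreStep C₂.toElem (h.Ψ.functor.map φ))
    (hprim' : ∀ ⦃X Y : C₂.category⦄ (φ : X ⟶ Y), PreFrobenioid.IsPrimaryPreStep C₂.toElem φ →
      PreFrobenioid.IsPrimaryPreStep C₁.toElem (h.Ψ.inverse.map φ))
    (hfrob : ∀ ⦃X Y : C₁.category⦄ (φ : X ⟶ Y), PreFrobenioid.IsFrobeniusType C₁.toElem φ →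
      PreFrobenioid.IsFrobeniusType C₂.toElem (h.Ψ.functor.map φ))
    (hfrob' : ∀ ⦃X Y : C₂.category⦄ (φ : X ⟶ Y), PreFrobenioid.IsFrobeniusType C₂.toElem φ →
      PreFrobenioid.IsFrobeniusType C₁.toElem (h.Ψ.inverse.map φ))
    (hD1₁ : ∀ (A : Dᵒᵖ) (y : C₁.Φ.carrier A), C₁.IsBaseFieldTheoreticDiv y → C₁.IsNonCuspidal y)
    (hD1₂ : ∀ (A : D'ᵒᵖ) (y : C₂.Φ.carrier A), C₂.IsBaseFieldTheoreticDiv y → C₂.IsNonCuspidal y)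
    (hR3₁ : ∀ (A : Dᵒᵖ) (x : C₁.Φ.carrier A) (𝔮 : Primes (Perfection (dm.Φ₀.obj (C₁.baseOp A)))),
      𝔮 ∈ supp ((hpf (C₁.baseOp A)).weak.realification.subtype (x : C₁.ΦRlog.obj A)) →
        ∃ y : C₁.Φ.carrier A, IsPrimary y ∧ Precsim y x ∧
          𝔮 ∈ supp ((hpf (C₁.baseOp A)).weak.realification.subtype (y : C₁.ΦRlog.obj A)))
    (hR3₂ : ∀ (A : D'ᵒᵖ) (x : C₂.Φ.carrier A) (𝔮 : Primes (Perfection (dm'.Φ₀.obj (C₂.baseOp A)))),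
      𝔮 ∈ supp ((hpf' (C₂.baseOp A)).weak.realification.subtype (x : C₂.ΦRlog.obj A)) →
        ∃ y : C₂.Φ.carrier A, IsPrimary y ∧ Precsim y x ∧
          𝔮 ∈ supp ((hpf' (C₂.baseOp A)).weak.realification.subtype (y : C₂.ΦRlog.obj A))) :
    Cor38_iii h :=
  cor38_iii_of_weak h hpre hpre' hprim hprim' hfrob hfrob'
    hD1₁ (fun _ x => C₁.eq_one_of_isNonCuspidal_of_isCuspidal_weak x)
    (fun A x => C₁.isNonCuspidal_iff_primaries_of_noPhantom_weak (hR3₁ A) x)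
    (fun A x => C₁.isCuspidal_iff_primaries_of_noPhantom_weak (hR3₁ A) x)
    hD1₂ (fun _ x => C₂.eq_one_of_isNonCuspidal_of_isCuspidal_weak x)
    (fun A x => C₂.isNonCuspidal_iff_primaries_of_noPhantom_weak (hR3₂ A) x)
    (fun A x => C₂.isCuspidal_iff_primaries_of_noPhantom_weak (hR3₂ A) x)

/-- **Cor. 3.8 (iii), pre-step clause, over `ofRlfZWeak` data, the [FrdI] rows DISCHARGED**: as
`cor38_iii_ofRlfZWeak`, with [FrdI] Thm. 3.4 (ii)/(iii) (C38-L02a, from the tree's proved `FrdI.thm34ii_ofFunctor` over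
`h.fsmff`), Thm. 3.7 (i)(ii) (C38-L01) and Thm. 4.2 (i) for weakly perf-factorial `Φ_i` (`hprim`/`hprim'`) supplied BY NAME
through `Cor38Hyp.cor38_iii_of_isFrobenioid_weak`.  Remaining inputs: `IsFrobenioid` ([FrdI] Thm. 5.2 (ii)), the datum
"base-field-theoretic ⇒ non-cuspidal" (`hD1`) and (R3) (`hR3`). [cite: MochizukiEtTh2009, Cor 3.8 p.81] -/
theorem cor38_iii_ofRlfZWeak_of_isFrobenioid
    (hF₁ : PreFrobenioid.IsFrobenioid C₁.toElem) (hF₂ : PreFrobenioid.IsFrobenioid C₂.toElem)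
    (hD1₁ : ∀ (A : Dᵒᵖ) (y : C₁.Φ.carrier A), C₁.IsBaseFieldTheoreticDiv y → C₁.IsNonCuspidal y)
    (hD1₂ : ∀ (A : D'ᵒᵖ) (y : C₂.Φ.carrier A), C₂.IsBaseFieldTheoreticDiv y → C₂.IsNonCuspidal y)
    (hR3₁ : ∀ (A : Dᵒᵖ) (x : C₁.Φ.carrier A) (𝔮 : Primes (Perfection (dm.Φ₀.obj (C₁.baseOp A)))),
      𝔮 ∈ supp ((hpf (C₁.baseOp A)).weak.realification.subtype (x : C₁.ΦRlog.obj A)) →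
        ∃ y : C₁.Φ.carrier A, IsPrimary y ∧ Precsim y x ∧
          𝔮 ∈ supp ((hpf (C₁.baseOp A)).weak.realification.subtype (y : C₁.ΦRlog.obj A)))
    (hR3₂ : ∀ (A : D'ᵒᵖ) (x : C₂.Φ.carrier A) (𝔮 : Primes (Perfection (dm'.Φ₀.obj (C₂.baseOp A)))),
      𝔮 ∈ supp ((hpf' (C₂.baseOp A)).weak.realification.subtype (x : C₂.ΦRlog.obj A)) →
        ∃ y : C₂.Φ.carrier A, IsPrimary y ∧ Precsim y x ∧
          𝔮 ∈ supp ((hpf' (C₂.baseOp A)).weak.realification.subtype (y : C₂.ΦRlog.obj A))) :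
    Cor38_iii h :=
  h.cor38_iii_of_isFrobenioid_weak hF₁ hF₂
    hD1₁ (fun _ x => C₁.eq_one_of_isNonCuspidal_of_isCuspidal_weak x)
    (fun A x => C₁.isNonCuspidal_iff_primaries_of_noPhantom_weak (hR3₁ A) x)
    (fun A x => C₁.isCuspidal_iff_primaries_of_noPhantom_weak (hR3₁ A) x)
    hD1₂ (fun _ x => C₂.eq_one_of_isNonCuspidal_of_isCuspidal_weak x)
    (fun A x => C₂.isNonCuspidal_iff_primaries_of_noPhantom_weak (hR3₂ A) x)
    (fun A x => C₂.isCuspidal_iff_primaries_of_noPhantom_weak (hR3₂ A) x)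

/-- **Cor. 3.8 (iii), pre-step clause, over `ofRlfZWeak`, the [FrdI] rows discharged and (R3) DISCHARGED for countably
many primes** (`noPhantom_of_countable_weak`).  Remaining inputs: `IsFrobenioid`, countability of the primes of the
`Φ_i(A)`, and the datum "base-field-theoretic ⇒ non-cuspidal" (`hD1`). [cite: MochizukiEtTh2009, Cor 3.8 p.81] -/
theorem cor38_iii_ofRlfZWeak_of_isFrobenioid_of_countable
    (hcnt₁ : ∀ A : Dᵒᵖ, Countable (Primes (Perfection ↥(C₁.Φ.carrier A))))
    (hcnt₂ : ∀ A : D'ᵒᵖ, Countable (Primes (Perfection ↥(C₂.Φ.carrier A))))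
    (hF₁ : PreFrobenioid.IsFrobenioid C₁.toElem) (hF₂ : PreFrobenioid.IsFrobenioid C₂.toElem)
    (hD1₁ : ∀ (A : Dᵒᵖ) (y : C₁.Φ.carrier A), C₁.IsBaseFieldTheoreticDiv y → C₁.IsNonCuspidal y)
    (hD1₂ : ∀ (A : D'ᵒᵖ) (y : C₂.Φ.carrier A), C₂.IsBaseFieldTheoreticDiv y → C₂.IsNonCuspidal y) :
    Cor38_iii h :=
  cor38_iii_ofRlfZWeak_of_isFrobenioid h hF₁ hF₂ hD1₁ hD1₂
    (fun A x 𝔮 h𝔮 => C₁.noPhantom_of_countable_weak A (hcnt₁ A) x 𝔮 h𝔮)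
    (fun A x 𝔮 h𝔮 => C₂.noPhantom_of_countable_weak A (hcnt₂ A) x 𝔮 h𝔮)

/-- **Cor. 3.8 (iii), pre-step clause, over the weak realified data `ofRlfZWeak` — EVERY row of the printed proof and
every §3-internal input discharged or reduced to base data**: [FrdI] Thm. 3.4 (ii)/(iii), Thm. 3.7 (i)(ii), Thm. 4.2 (i)
(weakly perf-factorial `Φ_i`) by name; (R3) by countability of the primes (`NoPhantomSupport`); `hD1` by the `Φ₀`-level
datum `hcn` "divisors of constants are quotients of non-cuspidal log-divisors" (Def. 3.1 (ii); `Sec3BsFldNcspWeak`).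
Remaining named inputs: `IsFrobenioid` ([FrdI] Thm. 5.2 (ii)), `hcnt` (GAP-LEDGER G-L2d2-4), `hcn` (G-L2d2-3).
[cite: MochizukiEtTh2009, Cor 3.8 p.81] -/
theorem cor38_iii_ofRlfZWeak_of_isFrobenioid_of_countable_of_cnst
    (hcnt₁ : ∀ A : Dᵒᵖ, Countable (Primes (Perfection ↥(C₁.Φ.carrier A))))
    (hcnt₂ : ∀ A : D'ᵒᵖ, Countable (Primes (Perfection ↥(C₂.Φ.carrier A))))
    (hcn₁ : ∀ (A : Dᵒᵖ) (b : dm.B₀.obj (C₁.baseOp A)), b ∈ dm.F₀ (C₁.baseOp A) →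
      ∃ n₁ n₂ : dm.Φ₀.obj (C₁.baseOp A), n₁ ∈ dm.ncsp₀ (C₁.baseOp A) ∧ n₂ ∈ dm.ncsp₀ (C₁.baseOp A) ∧
        dm.div₀ (C₁.baseOp A) b * Algebra.GrothendieckGroup.of n₂ = Algebra.GrothendieckGroup.of n₁)
    (hcn₂ : ∀ (A : D'ᵒᵖ) (b : dm'.B₀.obj (C₂.baseOp A)), b ∈ dm'.F₀ (C₂.baseOp A) →
      ∃ n₁ n₂ : dm'.Φ₀.obj (C₂.baseOp A), n₁ ∈ dm'.ncsp₀ (C₂.baseOp A) ∧ n₂ ∈ dm'.ncsp₀ (C₂.baseOp A) ∧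
        dm'.div₀ (C₂.baseOp A) b * Algebra.GrothendieckGroup.of n₂ = Algebra.GrothendieckGroup.of n₁)
    (hF₁ : PreFrobenioid.IsFrobenioid C₁.toElem) (hF₂ : PreFrobenioid.IsFrobenioid C₂.toElem) :
    Cor38_iii h :=
  cor38_iii_ofRlfZWeak_of_isFrobenioid_of_countable h hcnt₁ hcnt₂ hF₁ hF₂
    (C₁.isNonCuspidal_of_isBaseFieldTheoreticDiv_weak hcn₁)
    (C₂.isNonCuspidal_of_isBaseFieldTheoreticDiv_weak hcn₂)

/-- **Cor. 3.8 (iii), pre-step clause, over the weak realified data `ofRlfZWeak`, the `Φ₀`-datum read from abc-iut-L2-t3's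
[EtTh] Prop. 3.4 (ii) predicate bundle `DivisorMonoids.Prop34Const`** ("`div₀(c) = v_L(c) · div(ϖ_L)`" with `div(ϖ_L)`
non-cuspidal — `Prop34Const.hcn` gives exactly the binder `hcn` of `cor38_iii_ofRlfZWeak_of_isFrobenioid_of_countable_of_cnst`;
GAP-LEDGER disposition D-G-L2d2-3).  Remaining named inputs: `IsFrobenioid` ([FrdI] Thm. 5.2 (ii)), `hcnt` (G-L2d2-4),
`hC_i : dm_i.Prop34Const`. [cite: MochizukiEtTh2009, Cor 3.8 p.81] -/
theorem cor38_iii_ofRlfZWeak_of_isFrobenioid_of_countable_of_prop34Const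
    (hcnt₁ : ∀ A : Dᵒᵖ, Countable (Primes (Perfection ↥(C₁.Φ.carrier A))))
    (hcnt₂ : ∀ A : D'ᵒᵖ, Countable (Primes (Perfection ↥(C₂.Φ.carrier A))))
    (hC₁ : dm.Prop34Const) (hC₂ : dm'.Prop34Const)
    (hF₁ : PreFrobenioid.IsFrobenioid C₁.toElem) (hF₂ : PreFrobenioid.IsFrobenioid C₂.toElem) :
    Cor38_iii h :=
  cor38_iii_ofRlfZWeak_of_isFrobenioid_of_countable_of_cnst h hcnt₁ hcnt₂
    (fun A b hb => hC₁.hcn (C₁.baseOp A) b hb) (fun A b hb => hC₂.hcn (C₂.baseOp A) b hb) hF₁ hF₂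

end Cor38Weak

end Literature.AnabelianGeometry.EtaleTheta
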